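import Literature.AlgebraicGeometry.Motives.AbelianVarietyFrobeniusTwistVariety
import Literature.NumberTheory.DiophantineGeometry.AVIsogenyTate
import Mathlib.NumberTheory.NumberField.Basic
import Mathlib.NumberTheory.Padics.PadicVal.Basic
import Mathlib.RingTheory.SimpleRing.Basic
import Mathlib.Analysis.Complex.Basic
import HarnessLib

/-!
# Kottwitz 1992, §10 «Virtual abelian varieties over finite fields» (pp. 402–410): carriers and the
# numbered statements Lemma 10.1 – Lemma 10.13, Cor. 10.5, as named facts

R. E. Kottwitz, *Points on some Shimura varieties over finite fields*, J. Amer. Math. Soc. **5** (1992)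
373–444 [Kottwitz1992], §10, printed pp. 402–410 (held: `paper:doi-10-2307-2152772`, pdf page = printed
page − 372; every pin below was read on the materialised pages p0030–p0038).  Squad TK carpet (cell
`hodgecm-mathlib`, seat TK-t04); topic `NumberTheory/Kottwitz1992`, namespace
`Literature.NumberTheory.Kottwitz1992.VirtualAbelianVarieties`.  STATEMENTS ONLY: definitions with bodies
(the carriers of §10) and closed named facts `def Kottwitz1992_10_<m>_<name> : Prop` (D-0014); no theorem,
no `sorry`, no `axiom`, no instance, no notation.  Dedup (`rg 'cite: Kottwitz1992, §10'`, 14 tags):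
Lemma 10.1 and the arithmetic core of Cor. 10.5 are PROVED in ★ `NumberTheory/NumberFields/PositiveInvolutionCNumber`
(`exists_positiveInvolution_iff`, `eq_of_trace_mul_nonneg_of_mul_eq`) and are cited by name below, not restated; no
other numbered statement of §10 has a declaration in the tree.

## Setting (p. 402, verbatim)

«Let `k` be an algebraic closure of `𝔽_p`, let `σ` be the Frobenius automorphism `x ↦ x^p` of `k`, and for
any positive integer `r` denote by `k_r` the fixed field of `σ^r` on `k`, so that `k_r` is a field with `p^r`
elements. By a virtual abelian variety `A` over `k_r` up to prime-to-`p` isogeny we will mean a pair `(Ā, u)`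
consisting of an abelian variety `Ā` over `k` up to prime-to-`p` isogeny and a prime-to-`p` isogeny
`u : σ^r(Ā) → Ā`. We define the dimension `dim(A)` of `A` to be `dim(Ā)`. Of course a homomorphism from `A₁`
to `A₂` is a homomorphism `f : Ā₁ → Ā₂` such that `f u₁ = u₂ σ^r(f)`. We define the Frobenius element
`π_A ∈ End(A)` by `π_A := u ∘ Φ_r`, where `Φ_r` is the Frobenius morphism `Φ_r : Ā → σ^r(Ā)`. The condition
`f u₁ = u₂ σ^r(f)` is equivalent to the condition `f π₁ = π₂ f`; in particular `End(A)` is the centralizer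
of `π_A` in `End(Ā)`, which implies that `π_A` belongs to the center of `End(A)`.» (p. 402); «In this section
we will be concerned with the category `𝒱_r` of virtual abelian varieties over `k_r` up to isogeny: it has
the same objects …, but a homomorphism from `A₁` to `A₂` is now an element `f ∈ Hom(Ā₁, Ā₂)_ℚ` such that
`f π₁ = π₂ f`.» (pp. 402–403).

## Carriers (definitions with bodies; tree notions only)

* `VirtualAbelianVariety k p r` — Kottwitz's pair `(Ā, u)`: `A : AbelianVariety k` (★ `Motives.AbelianVariety`),
  the Frobenius twist `σ^r(Ā) = A.frobeniusTwist p r` and the relative Frobenius `Φ_r = A.relFrobenius p r`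
  (★ `Motives/AbelianVarietyFrobeniusTwistVariety`), and the prime-to-`p` QUASI-isogeny `u` PRESENTED as a
  fraction `m⁻¹ · u` — an honest homomorphism `u : σ^r(Ā) ⟶ Ā` admitting a prime-to-`p` quasi-inverse
  (`u ≫ v = N`, `v ≫ u = N`, `p ∤ N`) and a denominator `m` with `p ∤ m`.  Denominators are essential: the
  Frobenius element of an object of `𝒱_r` is `p`-integral but NOT an algebraic integer in general (e.g.
  `(E, u_can/3)` for an elliptic curve `E/𝔽_p`, `p ≠ 3`, has `π = π_E/3`, `c = p/9`), cf. the definition of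
  `c`-numbers (p. 405) which asks integrality at `p` only.  Presentations are not unique (no quotient is
  taken); every statement below is invariant under `(u, m) ∼ (m'u, m'm)`.
* `frobNum X = Φ_r ≫ u ∈ End(Ā)` and `frob X = π_A = m⁻¹ ⊗ (Φ_r ≫ u) ∈ End⁰(Ā) = ℚ ⊗ End(Ā)` (★ `endAlgebra`);
  `endAlg X = End_{𝒱_r}(A)` = the centralizer of `π_A` in `End⁰(Ā)` (p. 402 «`End(A)` is the centralizer of
  `π_A`», read in `𝒱_r`); `frobAlg X = ℚ[π_A]`; `IsHom X Y f` (`f π_X = π_Y f` for an honest `f : Ā_X ⟶ Ā_Y`,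
  cleared of denominators); `IsIsoV` (isomorphism in `𝒱_r` = an isogeny compatible with the Frobenius
  elements); `IsSimpleV` (simple object: `End_{𝒱_r}` a division algebra and `dim > 0` — faithful because
  `𝒱_{r,c}` is semisimple abelian with finite-dimensional Hom, Lemma 10.9).
* `InVc X c` — **membership of `𝒱_{r,c}`** («the full subcategory of `𝒱_r` whose objects are `c`-polarizable»,
  p. 407) typed through the FROBENIUS CHARACTERISATION that §10 itself proves: `π_A` semisimple (Lemma 10.2)
  and every `ℚ`-algebra homomorphism `ℚ[π_A] → ℂ` sends `π_A` to absolute value `c^{1/2}` (Lemma 10.3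
  (1)⇔(3)).  DICTIONARY, recorded not hidden: Kottwitz's definition of a `c`-polarization («a polarization `λ`
  of `Ā` such that `π_A^*(λ) = cλ`», p. 403, a `ℚ`-polarization in the sense of §9) needs the dual abelian
  variety over `𝔽̄_p`; the tree carries duals/polarisations only as the scheme-level INTERFACE
  ★ `AbelianSchemes/AbelianSchemeDualPair` + ★ `AbelianSchemePolarization` (no inhabitant over `𝔽̄_p`), so the
  polarization-theoretic clauses — Lemma 10.2 clause 1 («`π_A` is semisimple»), Lemma 10.3 (1)⇔(2), and the
  wording of Cor. 10.5 — are the dictionary by which `InVc` is read; their algebraic halves are typed.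
* `IsCNumber p c a` — «an algebraic number `a ∈ ℚ̄` is a `c`-number if the image of `a` under any embedding
  `ℚ̄ → ℚ̄_p` lies in the valuation ring of `ℚ̄_p` and the image of `a` under any embedding `ℚ̄ → ℂ` has absolute
  value `c^{1/2}`» (p. 405), for `a` in a number field `K`: `p`-integrality ⟺ `a` is integral over `ℤ_(p)` ⟺
  `a` is a root of an integer polynomial whose leading coefficient is prime to `p` ([folklore]: the valuation
  ring of `ℚ̄_p` meets `ℚ̄` in the integral closure of `ℤ_(p)`), and `‖φ a‖² = c` for every `φ : K →+* ℂ`.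
* `B`-objects (§3, p. 409): `i : B →ₐ[ℚ] End⁰(Ā)` with image in `End_{𝒱_r}(A)`; `endAlgB`, `frobAlgF` (`F[π]`),
  `IsSimpleBV`, `IsBHom`.

## Numbered statements (verbatim numbering; what is typed, what is not)

* Lemma 10.1 (p. 404) — ALREADY A THEOREM of the tree: ★ `Literature.NumberTheory.NumberFields.PositiveInvolutionCNumber.
  exists_positiveInvolution_iff` (`K = ℚ(π)`, `ℚ⟮π⟯ = ⊤`, `c > 0`: a positive involution `ρ` with `ρ(π) π = c` exists iff
  `‖φ π‖² = c` for all `φ : K →+* ℂ`; involutivity by ★ `apply_apply_of_trace_mul_nonneg`) — CITED, not restated.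
* `Kottwitz1992_10_2_…` Lemma 10.2 (pp. 404–405) — clause 2 («`End(A)` is semisimple») typed; clause 1 is the
  first conjunct of `InVc` (dictionary above).
* `Kottwitz1992_10_3_…` Lemma 10.3 (p. 405) — (2)⇔(3) typed over `ℚ[π_A] ⊆ End⁰(Ā)`; (1) is the dictionary.
* `Kottwitz1992_10_4_…` Lemma 10.4, `Kottwitz1992_10_5_…` Cor. 10.5, `Kottwitz1992_10_6_…` Lemma 10.6 (p. 405) —
  typed.
* `Kottwitz1992_10_7_…` Lemma 10.7 (p. 406) — typed on the INTEGRAL Tate modules (★ `tateModuleMap`): the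
  rational isomorphism `Hom_{𝒱_r}(A₁,A₂) ⊗ ℚ_ℓ ≅ Hom_π(V_ℓ Ā₁, V_ℓ Ā₂)` ⟺ (every `π`-intertwining `ℤ_ℓ`-linear
  map is, up to a power of `ℓ`, a `ℤ_ℓ`-combination of `T_ℓ(f)`, `f ∈ Hom_{𝒱_r}`) ∧ (`ℤ`-independent
  elements of `Hom_{𝒱_r}` have `ℤ_ℓ`-independent images).
* Lemma 10.8 (pp. 406–407; «the canonical map `End(A) ⊗_ℚ ℚ_p → End_Φ(H)` is an isomorphism», `H` the
  `L_r`-isocrystal of `A`) — NOT TYPED: the tree has no Dieudonné module / `H¹_cris` of an abelian variety over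
  `𝔽̄_p` as an object (only the Weil-cohomology interface ★ `Motives.CrystallineRealization`); owed to §11's
  isocrystal carpet (`Kottwitz1992/Isocrystals`).
* `Kottwitz1992_10_9_…` Lemma 10.9 (p. 407) — the clause «`Hom(A₁, A₂)` is finite dimensional» typed (as finite
  generation of the group of honest `𝒱_r`-homomorphisms); «abelian and semisimple, finite length» NOT typed (a
  category instance is outside the typer's licence) — it is USED, as printed, to justify `IsSimpleV`.
* `Kottwitz1992_10_10_…` Lemma 10.10 (p. 407) — typed.
* `Kottwitz1992_10_11_…` Lemma 10.11 (pp. 407–408) — the dimension identity typed (squared, over `ℚ`: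
  `(2 dim Ā)² = [ℚ[π]:ℚ] · dim_ℚ E`); the Hasse-invariant table NOT typed (no Brauer invariants of central
  simple algebras over number fields in Mathlib/tree).
* `Kottwitz1992_10_12_…` Lemma 10.12 (p. 408) — typed.
* `Kottwitz1992_10_13_…` Lemma 10.13 (pp. 409–410) — surjectivity (`_exists`), injectivity (`_unique`) of
  `π ↦ X_π` and the dimension identity (`_dim`) typed; the invariant table NOT typed (as for 10.11).

Conventions.  `k` is an algebraic closure of `𝔽_p`: `IsAlgClosed k`, `CharP k p` and `Algebra.IsAlgebraic (ZMod p) k`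
(the paper's proofs — 10.6 «defined over `k_{rs}`», 10.7 [T2], 10.12 Honda–Tate — use `k = 𝔽̄_p`).  `r` is a positive
integer throughout (hypothesis `0 < r`); from Lemma 10.4 on «`c` will denote a
positive rational number of the form `p^r c₀`, where `c₀` is a `p`-adic unit» (p. 405) — hypotheses `0 < c`,
`padicValRat p c = r`.  «`π` is a semisimple element» of the finite-dimensional `ℚ`-algebra `End⁰(Ā)` is typed
as separability of its minimal polynomial over `ℚ` ([folklore], characteristic `0`).  A positive involution of
the commutative `ℚ`-algebra `ℚ[π]` is an involutive `ℚ`-algebra automorphism `*` with `tr(x x*) > 0` for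
`x ≠ 0` ([Kottwitz1992, §2 Lemma 2.2 (3) and Definition, p. 380], over `ℝ`; a rational quadratic form positive
on `ℚ`-points is positive definite over `ℝ`, its radical being defined over `ℚ` — [folklore]).
HC_CM is proved only modulo the 7 printed citations until rung 0 closes; this file bears on none of them.

## References
* [Kottwitz1992] R. E. Kottwitz, J. Amer. Math. Soc. 5 (1992), §10 pp. 402–410; §2 p. 380; §3; §9 p. 401.
* [Tate1966Endomorphisms] J. Tate, Invent. Math. 2 (1966) — Kottwitz's [T2], used in 10.6–10.7.
* [Tate1971HondaBourbaki], [Honda1968] — Kottwitz's [T3], [H], used in 10.12.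
-/

noncomputable section

open CategoryTheory Polynomial

universe u

namespace Literature.NumberTheory.Kottwitz1992.VirtualAbelianVarieties

open Literature.AlgebraicGeometry.Motives Literature.AlgebraicGeometry.Motives.AbelianVariety

/-! ## §10 p. 402: virtual abelian varieties over `k_r` up to prime-to-`p` isogeny -/

/-- **Virtual abelian variety over `k_r` up to prime-to-`p` isogeny** [Kottwitz1992, §10 p. 402]: «a pair
`(Ā, u)` consisting of an abelian variety `Ā` over `k` up to prime-to-`p` isogeny and a prime-to-`p` isogeny
`u : σ^r(Ā) → Ā`».  Here `k` is a field of characteristic `p` (Kottwitz: `k = 𝔽̄_p`; the statements below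
assume `k` algebraically closed AND algebraic over `𝔽_p = ZMod p`, i.e. an algebraic closure of `𝔽_p`), `σ^r(Ā) = A.frobeniusTwist p r`, and the prime-to-`p` quasi-isogeny is presented as
`m⁻¹ · u` with `u` an honest homomorphism admitting a prime-to-`p` quasi-inverse and `p ∤ m` (module
docstring, «Carriers»). [cite: Kottwitz1992, §10 (p. 402)] -/
structure VirtualAbelianVariety (k : Type u) [Field k] (p : ℕ) [Fact p.Prime] [CharP k p] (r : ℕ) where
  /-- The abelian variety `Ā` over `k`. -/
  A : AbelianVariety k
  /-- The numerator of the prime-to-`p` quasi-isogeny `σ^r(Ā) → Ā`. -/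
  u : A.frobeniusTwist p r ⟶ A
  /-- The denominator (prime to `p`) of the quasi-isogeny `m⁻¹ · u`. -/
  m : ℕ
  /-- `p ∤ m` (in particular `m ≠ 0`). -/
  not_dvd : ¬ p ∣ m
  /-- `u` is invertible in `Hom ⊗ ℤ_(p)`: a quasi-inverse `v` with `u ≫ v = N`, `v ≫ u = N`, `p ∤ N`. -/
  exists_inv : ∃ (v : A ⟶ A.frobeniusTwist p r) (N : ℕ), ¬ p ∣ N ∧
    u ≫ v = N • 𝟙 (A.frobeniusTwist p r) ∧ v ≫ u = N • 𝟙 A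

namespace VirtualAbelianVariety

variable {k : Type u} [Field k] {p : ℕ} [Fact p.Prime] [CharP k p] {r : ℕ}
variable (X : VirtualAbelianVariety k p r)

/-- The honest endomorphism `Φ_r ≫ u = u ∘ Φ_r ∈ End(Ā)` — `m` times the Frobenius element
(`Φ_r = A.relFrobenius p r : Ā → σ^r(Ā)` the relative `p^r`-Frobenius). [cite: Kottwitz1992, §10 (p. 402)] -/
def frobNum : End X.A := X.A.relFrobenius p r ≫ X.u

/-- **The Frobenius element `π_A := u ∘ Φ_r`** [Kottwitz1992, §10 p. 402], as the element
`m⁻¹ ⊗ (Φ_r ≫ u)` of `End⁰(Ā) = ℚ ⊗_ℤ End(Ā)` (★ `AbelianVariety.endAlgebra`). [cite: Kottwitz1992, §10 (p. 402)] -/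
def frob : X.A.endAlgebra :=
  algebraMap ℚ X.A.endAlgebra (X.m : ℚ)⁻¹ * endAlgebra.of X.A X.frobNum

/-- **`End(A) = End_{𝒱_r}(A)`**, the centralizer of `π_A` in `End⁰(Ā)`: «`End(A)` is the centralizer of `π_A`
in `End(Ā)`» (p. 402), read in the category `𝒱_r` up to isogeny («an element `f ∈ Hom(Ā₁, Ā₂)_ℚ` such that
`f π₁ = π₂ f`», p. 403). [cite: Kottwitz1992, §10 (pp. 402–403)] -/
def endAlg : Subalgebra ℚ X.A.endAlgebra := Subalgebra.centralizer ℚ {X.frob}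

/-- `ℚ[π]`, «the semisimple commutative `ℚ`-subalgebra of `End(A)_ℚ` generated by `π := π_A`» (Lemma 10.3/10.4,
p. 405). [cite: Kottwitz1992, §10 Lemma 10.3 (p. 405)] -/
def frobAlg : Subalgebra ℚ X.A.endAlgebra := Algebra.adjoin ℚ {X.frob}

/-- `π_A` as an element of `ℚ[π_A]`. [cite: Kottwitz1992, §10 Lemma 10.3 (p. 405)] -/
def frobGen : X.frobAlg := ⟨X.frob, Algebra.self_mem_adjoin_singleton ℚ X.frob⟩

/-- **`A ∈ 𝒱_{r,c}`** («the full subcategory of `𝒱_r` whose objects are `c`-polarizable virtual abelian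
varieties over `k_r` up to isogeny», p. 407), typed through the Frobenius characterisation PROVED in §10:
`π_A` is a semisimple element of `End⁰(Ā)` (Lemma 10.2: «Let `A` be a `c`-polarizable virtual abelian variety …
Then `π := π_A` is a semisimple element») AND «(3) For every `ℚ`-algebra homomorphism from `ℚ[π]` to `ℂ` the
image of `π` has absolute value `c^{1/2}`» (Lemma 10.3, equivalent to «(1) The virtual abelian variety `A` is
`c`-polarizable» under semisimplicity).  Semisimple element := separable minimal polynomial over `ℚ`
(characteristic `0`, [folklore]).  The polarization-theoretic definition of `𝒱_{r,c}` (p. 403) is the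
dictionary recorded in the module docstring. [cite: Kottwitz1992, §10 Lemma 10.2 (p. 404), Lemma 10.3 (p. 405), p. 407] -/
def InVc (c : ℚ) : Prop :=
  (minpoly ℚ X.frob).Separable ∧ ∀ φ : X.frobAlg →ₐ[ℚ] ℂ, ‖φ X.frobGen‖ ^ 2 = (c : ℝ)

variable {X} in
/-- **Homomorphisms in `𝒱_r`** on honest representatives: `f : Ā_X ⟶ Ā_Y` with «`f π₁ = π₂ f`» (p. 403),
denominators cleared (`π = m⁻¹ (Φ_r ≫ u)`): `m_Y • (frobNum_X ≫ f) = m_X • (f ≫ frobNum_Y)`.  Every element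
of `Hom_{𝒱_r}(X, Y) ⊆ Hom(Ā_X, Ā_Y)_ℚ` is `n⁻¹ f` for such an `f`. [cite: Kottwitz1992, §10 (pp. 402–403)] -/
def IsHom (Y : VirtualAbelianVariety k p r) (f : X.A ⟶ Y.A) : Prop :=
  Y.m • (X.frobNum ≫ f) = X.m • (f ≫ Y.frobNum)

/-- **`X ≅ Y` in `𝒱_r`**: an isomorphism in `𝒱_r` is an invertible element of `Hom(Ā_X, Ā_Y)_ℚ` compatible with
the Frobenius elements; clearing denominators, equivalently an ISOGENY `f : Ā_X → Ā_Y` with `f π_X = π_Y f`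
(an honest homomorphism is invertible in `Hom_ℚ` iff it is an isogeny). [cite: Kottwitz1992, §10 (pp. 402–403)] -/
def IsIsoV (Y : VirtualAbelianVariety k p r) : Prop :=
  ∃ f : X.A ⟶ Y.A, IsIsogeny f ∧ IsHom Y f

/-- **Simple object of `𝒱_{r,c}`** (Lemmas 10.10–10.12): `Ā ≠ 0` and `End_{𝒱_r}(X)` is a division algebra.
Faithful to «simple object» because `𝒱_{r,c}` is a semisimple abelian `ℚ`-linear category with
finite-dimensional Hom (Lemma 10.9, p. 407): an object `⊕ Sᵢ^{nᵢ}` has `End = ∏ M_{nᵢ}(Dᵢ)`, a division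
algebra iff it is simple; cf. «If `A` is a simple object, then `E := End(A)` is a finite-dimensional central
division algebra over `ℚ[π] ⊂ E`» (p. 407). [cite: Kottwitz1992, §10 Lemma 10.9 and p. 407] -/
def IsSimpleV : Prop :=
  0 < X.A.dim ∧ ∀ x ∈ X.endAlg, x ≠ 0 → ∃ y ∈ X.endAlg, x * y = 1 ∧ y * x = 1

/-! ### `B`-objects (§3; §10 p. 409) -/

section BObjects

variable {B : Type*} [Ring B] [Algebra ℚ B]

/-- **`End_B(X)`** for a `B`-object `(X, i)` of `𝒱_r` (`i : B → End_{𝒱_r}(X)` a `ℚ`-algebra homomorphism, §3):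
the endomorphisms in `𝒱_r` commuting with `i(B)` — the centralizer of `i(B) ∪ {π_X}` in `End⁰(Ā)`.
[cite: Kottwitz1992, §10 (p. 409), §3] -/
def endAlgB (i : B →ₐ[ℚ] X.A.endAlgebra) : Subalgebra ℚ X.A.endAlgebra :=
  Subalgebra.centralizer ℚ (Set.range i ∪ {X.frob})

/-- **`F[π]`** for a `B`-object `(X, i)`, `F` a subfield of the centre of `B` acting through `i`: the
`ℚ`-subalgebra of `End⁰(Ā)` generated by `i(F)` and `π_X` (Lemma 10.13: «a central division algebra `C` over
`F[π]`»). [cite: Kottwitz1992, §10 Lemma 10.13 (p. 409)] -/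
def frobAlgF (F : Type*) [Field F] [Algebra F B] (i : B →ₐ[ℚ] X.A.endAlgebra) :
    Subalgebra ℚ X.A.endAlgebra :=
  Algebra.adjoin ℚ (i '' Set.range (algebraMap F B) ∪ {X.frob})

/-- `π_X` as an element of `F[π_X]`. [cite: Kottwitz1992, §10 Lemma 10.13 (p. 409)] -/
def frobGenF (F : Type*) [Field F] [Algebra F B] (i : B →ₐ[ℚ] X.A.endAlgebra) : X.frobAlgF F i :=
  ⟨X.frob, Algebra.subset_adjoin (Set.mem_union_right _ (Set.mem_singleton _))⟩

/-- **Simple `B`-object** of `𝒱_{r,c,B}` («the category `𝒱_{r,c,B}` of `B`-objects in the category of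
`c`-polarizable virtual abelian varieties over `k_r` up to isogeny», p. 409): `i(B) ⊆ End_{𝒱_r}(X)`, `Ā ≠ 0`,
and `End_B(X)` is a division algebra (faithful as for `IsSimpleV`: the category of `B`-objects in a
semisimple `ℚ`-linear abelian category with finite-dimensional Hom is again such, §3).
[cite: Kottwitz1992, §10 (p. 409), §3] -/
def IsSimpleBV (i : B →ₐ[ℚ] X.A.endAlgebra) : Prop :=
  (∀ b, i b ∈ X.endAlg) ∧ 0 < X.A.dim ∧ ∀ x ∈ X.endAlgB i, x ≠ 0 → ∃ y ∈ X.endAlgB i, x * y = 1 ∧ y * x = 1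

variable {X} in
/-- **`B`-linearity** of an honest homomorphism `f : Ā_X ⟶ Ā_Y` between `B`-objects `(X, i)`, `(Y, j)`:
`f ∘ i(b) = j(b) ∘ f` in `Hom(Ā_X, Ā_Y)_ℚ` for all `b ∈ B`, written on representatives — whenever
`i(b) = n⁻¹ ⊗ e` and `j(b) = n⁻¹ ⊗ e'` with honest `e, e'`, then `e ≫ f = f ≫ e'` (every element of `ℚ ⊗ End`
has such a representation and `Hom` is torsion-free, [folklore]). [cite: Kottwitz1992, §3, §10 (p. 409)] -/
def IsBHom (Y : VirtualAbelianVariety k p r) (i : B →ₐ[ℚ] X.A.endAlgebra) (j : B →ₐ[ℚ] Y.A.endAlgebra)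
    (f : X.A ⟶ Y.A) : Prop :=
  ∀ (b : B) (n : ℕ) (e : End X.A) (e' : End Y.A), n ≠ 0 →
    i b = algebraMap ℚ X.A.endAlgebra (n : ℚ)⁻¹ * endAlgebra.of X.A e →
    j b = algebraMap ℚ Y.A.endAlgebra (n : ℚ)⁻¹ * endAlgebra.of Y.A e' →
    e ≫ f = f ≫ e'

end BObjects

end VirtualAbelianVariety

/-- **`c`-number** [Kottwitz1992, §10 p. 405]: «We say that an algebraic number `a ∈ ℚ̄` is a `c`-number if the
image of `a` under any embedding `ℚ̄ → ℚ̄_p` lies in the valuation ring of `ℚ̄_p` and the image of `a` under any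
embedding `ℚ̄ → ℂ` has absolute value `c^{1/2}`.»  Typed for `a` in a number field `K`: `a` is integral over
`ℤ_(p)` — a root of an integer polynomial whose leading coefficient is prime to `p` (⟺ every conjugate of `a` is
`p`-adically integral, [folklore]) — and `‖φ a‖² = c` for every `φ : K →+* ℂ`. [cite: Kottwitz1992, §10 (p. 405)] -/
def IsCNumber (p : ℕ) (c : ℚ) {K : Type*} [Field K] [NumberField K] (a : K) : Prop :=
  (∃ P : ℤ[X], ¬ ((p : ℤ) ∣ P.leadingCoeff) ∧ aeval a P = 0) ∧ ∀ φ : K →+* ℂ, ‖φ a‖ ^ 2 = (c : ℝ)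

open VirtualAbelianVariety

/-! ## Lemma 10.2 (pp. 404–405) -/

/-- **[Kottwitz1992, Lemma 10.2 (p. 404)]**, verbatim: «Let `A` be a `c`-polarizable virtual abelian variety over
`k_r` up to isogeny (for some positive rational number `c`). Then `π := π_A` is a semisimple element of `End(A)`.
Moreover the `ℚ`-algebra `End(A)` is semisimple.»  Typed: the second clause — for `A ∈ 𝒱_{r,c}` (`InVc`, whose
first conjunct IS the first clause, see the dictionary in the module docstring) the algebra `End_{𝒱_r}(A)`, the
centralizer of `π_A` in `End⁰(Ā)`, is a semisimple ring (proof printed p. 405: «`End(A)` is the centralizer of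
`π` in the semisimple algebra `End(Ā)`»). [cite: Kottwitz1992, Lemma 10.2 (pp. 404–405)] -/
def Kottwitz1992_10_2_endAlg_isSemisimpleRing : Prop :=
  ∀ (k : Type) [Field k] [IsAlgClosed k] (p : ℕ) [Fact p.Prime] [CharP k p] [Algebra (ZMod p) k]
    [Algebra.IsAlgebraic (ZMod p) k] (r : ℕ), 0 < r →
    ∀ (X : VirtualAbelianVariety k p r) (c : ℚ), 0 < c → X.InVc c → IsSemisimpleRing X.endAlg

/-! ## Lemma 10.3 (p. 405) -/

/-- **[Kottwitz1992, Lemma 10.3 (p. 405)]**, verbatim: «Let `c` be a positive rational number and let `A` be a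
virtual abelian variety over `k_r` up to prime-to-`p` isogeny. Assume that `π := π_A` is a semisimple element of
`End(A)_ℚ`, and let `ℚ[π]` denote the semisimple commutative `ℚ`-subalgebra it generates. Then the following
three conditions are equivalent. (1) The virtual abelian variety `A` is `c`-polarizable. (2) There exists a
positive involution on `ℚ[π]` that carries `π` into `cπ⁻¹`. (3) For every `ℚ`-algebra homomorphism from `ℚ[π]`
to `ℂ` the image of `π` has absolute value `c^{1/2}`.»  Typed: (2) ⇔ (3) for `ℚ[π_A] ⊆ End⁰(Ā)` (positive
involution of the commutative `ℚ`-algebra `ℚ[π]`: an involutive `ℚ`-algebra automorphism `σ` with `tr(x σx) > 0` for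
`x ≠ 0`, [Kottwitz1992, §2 Def. p. 380, Lemma 2.2 (3)]); (1) ⇔ (3) is the dictionary defining `InVc`.  «Proved exactly the
same way as Lemma 10.1» — and Lemma 10.1 itself (the FIELD case `ℚ[π] = ℚ(π)`, `π ∈ ℚ̄^×`) IS A THEOREM of the tree:
★ `Literature.NumberTheory.NumberFields.PositiveInvolutionCNumber.exists_positiveInvolution_iff` (cited, not restated). [cite: Kottwitz1992, Lemma 10.3 (p. 405)] -/
def Kottwitz1992_10_3_positiveInvolution_iff_absValue : Prop :=
  ∀ (k : Type) [Field k] [IsAlgClosed k] (p : ℕ) [Fact p.Prime] [CharP k p] [Algebra (ZMod p) k]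
    [Algebra.IsAlgebraic (ZMod p) k] (r : ℕ), 0 < r →
    ∀ (X : VirtualAbelianVariety k p r) (c : ℚ), 0 < c → (minpoly ℚ X.frob).Separable →
    ((∃ σ : X.frobAlg ≃ₐ[ℚ] X.frobAlg, (∀ x, σ (σ x) = x) ∧
        (∀ x : X.frobAlg, x ≠ 0 →
          0 < LinearMap.trace ℚ X.frobAlg (LinearMap.mulLeft ℚ (x * σ x))) ∧
        σ X.frobGen * X.frobGen = algebraMap ℚ X.frobAlg c) ↔
      ∀ φ : X.frobAlg →ₐ[ℚ] ℂ, ‖φ X.frobGen‖ ^ 2 = (c : ℝ))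

/-! ## Lemma 10.4, Corollary 10.5, Lemma 10.6 (p. 405) -/

/-- **[Kottwitz1992, Lemma 10.4 (p. 405)]**, verbatim: «Let `A` be a `c`-polarizable virtual abelian variety over
`k_r` up to prime-to-`p` isogeny, and let `ℚ[π]` denote the semisimple commutative `ℚ`-subalgebra of `End(A)_ℚ`
generated by `π := π_A`. Then the image of `π` under any `ℚ`-algebra homomorphism `ℚ[π] → ℚ̄` is a
`c`-number.»  Here (p. 405) «`c` will denote a positive rational number of the form `p^r c₀`, where `c₀` is a
`p`-adic unit»; `ℚ̄` is read as: any number field `K`. [cite: Kottwitz1992, Lemma 10.4 (p. 405)] -/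
def Kottwitz1992_10_4_frob_isCNumber : Prop :=
  ∀ (k : Type) [Field k] [IsAlgClosed k] (p : ℕ) [Fact p.Prime] [CharP k p] [Algebra (ZMod p) k]
    [Algebra.IsAlgebraic (ZMod p) k] (r : ℕ), 0 < r →
    ∀ (c : ℚ), 0 < c → padicValRat p c = r →
    ∀ (X : VirtualAbelianVariety k p r), X.InVc c →
    ∀ (K : Type) [Field K] [NumberField K] (φ : X.frobAlg →ₐ[ℚ] K), IsCNumber p c (φ X.frobGen)

/-- **[Kottwitz1992, Corollary 10.5 (p. 405)]**, verbatim: «Let `A` be a virtual abelian variety over `k_r` up to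
prime-to-`p` isogeny. There is at most one value of `c` for which `A` is `c`-polarizable.» («This is obvious,
since `c` can be recovered by embedding `ℚ[π]` in `ℂ` and taking the square of the absolute value of `π`.»)
Typed through `InVc`, for `Ā ≠ 0` (its arithmetic core in the field case is the tree's theorem
★ `PositiveInvolutionCNumber.eq_of_trace_mul_nonneg_of_mul_eq`). [cite: Kottwitz1992, Corollary 10.5 (p. 405)] -/
def Kottwitz1992_10_5_c_unique : Prop :=
  ∀ (k : Type) [Field k] [IsAlgClosed k] (p : ℕ) [Fact p.Prime] [CharP k p] [Algebra (ZMod p) k]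
    [Algebra.IsAlgebraic (ZMod p) k] (r : ℕ), 0 < r →
    ∀ (X : VirtualAbelianVariety k p r) (c c' : ℚ), 0 < X.A.dim → X.InVc c → X.InVc c' → c = c'

/-- **[Kottwitz1992, Lemma 10.6 (p. 405)]**, verbatim: «Let `A` be a virtual abelian variety over `k_r` up to
isogeny. Suppose that `π := π_A` is a semisimple element of `End(A)` (for example, suppose that `A` is
`c`-polarizable). Then the `ℚ`-subalgebra `ℚ[π]` generated by `π` in `End(A)` is the center of `End(A)`.»
(`End(A) = End_{𝒱_r}(A)`; proof p. 406 via [T2] = Tate 1966.) [cite: Kottwitz1992, Lemma 10.6 (p. 405)] -/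
def Kottwitz1992_10_6_center_endAlg_eq_frobAlg : Prop :=
  ∀ (k : Type) [Field k] [IsAlgClosed k] (p : ℕ) [Fact p.Prime] [CharP k p] [Algebra (ZMod p) k]
    [Algebra.IsAlgebraic (ZMod p) k] (r : ℕ), 0 < r →
    ∀ (X : VirtualAbelianVariety k p r), (minpoly ℚ X.frob).Separable →
    ∀ x ∈ X.endAlg, (∀ y ∈ X.endAlg, x * y = y * x) ↔ x ∈ X.frobAlg

/-! ## Lemma 10.7 (p. 406) -/

/-- **[Kottwitz1992, Lemma 10.7 (p. 406)]**, verbatim: «Let `A` be a virtual abelian variety over `k_r` up to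
isogeny. Suppose that `π := π_A` is a semisimple element of `End(A)`. Then for every prime `l` different from `p`
the canonical map `End(A) ⊗_ℚ ℚ_l → End_π(H₁(Ā, ℚ_l))` is an isomorphism, where `End_π(H₁(Ā, ℚ_l))` denotes the
ring of endomorphisms of `H₁(Ā, ℚ_l)` that commute with `π`. The analogous statement with `Hom(·,·)` replacing
`End(·)` also holds.»  Typed in the `Hom` form (which contains the `End` form, `A₁ = A₂`) on the INTEGRAL Tate
modules `T_ℓ Ā = H₁(Ā, ℤ_ℓ)` (★ `AbelianVariety.tateModule`, ★ `tateModuleMap`): SURJECTIVITY — every `ℤ_ℓ`-linear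
`g : T_ℓ Ā₁ → T_ℓ Ā₂` with `g V(π₁) = V(π₂) g` (denominators cleared) is, up to a power of `ℓ`, a
`ℤ_ℓ`-combination of the `T_ℓ(f)`, `f` an honest `𝒱_r`-homomorphism; INJECTIVITY — `ℤ`-linearly independent
honest `𝒱_r`-homomorphisms have `ℤ_ℓ`-linearly independent images. [cite: Kottwitz1992, Lemma 10.7 (p. 406)] -/
def Kottwitz1992_10_7_tateModule_hom_iso : Prop :=
  ∀ (k : Type) [Field k] [IsAlgClosed k] (p : ℕ) [Fact p.Prime] [CharP k p] [Algebra (ZMod p) k]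
    [Algebra.IsAlgebraic (ZMod p) k] (r : ℕ), 0 < r →
    ∀ (X Y : VirtualAbelianVariety k p r), (minpoly ℚ X.frob).Separable → (minpoly ℚ Y.frob).Separable →
    ∀ (ℓ : ℕ) [Fact ℓ.Prime], ℓ ≠ p →
      (∀ g : X.A.tateModule ℓ →ₗ[ℤ_[ℓ]] Y.A.tateModule ℓ,
          Y.m • (g ∘ₗ tateModuleMap ℓ X.frobNum) = X.m • (tateModuleMap ℓ Y.frobNum ∘ₗ g) →
          ∃ N : ℕ, ((ℓ : ℤ_[ℓ]) ^ N) • g ∈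
            Submodule.span ℤ_[ℓ] (tateModuleMap ℓ '' {f : X.A ⟶ Y.A | IsHom Y f})) ∧
      (∀ (n : ℕ) (f : Fin n → (X.A ⟶ Y.A)), (∀ i, IsHom Y (f i)) → LinearIndependent ℤ f →
          LinearIndependent ℤ_[ℓ] fun i => tateModuleMap ℓ (f i))

/-! ## Lemma 10.9 (p. 407), the finiteness clause -/

/-- **[Kottwitz1992, Lemma 10.9 (p. 407)]**, verbatim: «The `ℚ`-linear category `𝒱_{r,c}` is abelian and
semisimple. All of its objects have finite length, and for any two objects `A₁, A₂` the `ℚ`-vector space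
`Hom(A₁, A₂)` is finite dimensional.»  Typed: the last clause — the group of honest `𝒱_r`-homomorphisms
`Ā₁ → Ā₂` (whose `ℚ`-span is `Hom_{𝒱_{r,c}}(A₁, A₂)`) is finitely generated — recorded for completeness only: it
already follows from the finite generation of `Hom(Ā₁, Ā₂)` ([MumfordAV1970, §19 Thm. 3]) and carries none of the
lemma's specific content.  «Abelian and semisimple, finite length» is not typed (module docstring).
[cite: Kottwitz1992, Lemma 10.9 (p. 407)] -/
def Kottwitz1992_10_9_hom_finitelyGenerated : Prop :=
  ∀ (k : Type) [Field k] [IsAlgClosed k] (p : ℕ) [Fact p.Prime] [CharP k p] [Algebra (ZMod p) k]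
    [Algebra.IsAlgebraic (ZMod p) k] (r : ℕ), 0 < r →
    ∀ (c : ℚ), 0 < c → padicValRat p c = r →
    ∀ (X Y : VirtualAbelianVariety k p r), X.InVc c → Y.InVc c →
    ∃ (n : ℕ) (f : Fin n → (X.A ⟶ Y.A)), (∀ i, IsHom Y (f i)) ∧
      ∀ g : X.A ⟶ Y.A, IsHom Y g → g ∈ AddSubgroup.closure (Set.range f)

/-! ## Lemma 10.10 (p. 407) -/

/-- **[Kottwitz1992, Lemma 10.10 (p. 407)]**, verbatim: «Let `A₁, A₂` be two simple objects in `𝒱_{r,c}` with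
Frobenius elements `π₁, π₂`. Suppose that there exists an isomorphism `ℚ[π₁] → ℚ[π₂]` carrying `π₁` into `π₂`.
Then `A₁` and `A₂` are isomorphic.» [cite: Kottwitz1992, Lemma 10.10 (p. 407)] -/
def Kottwitz1992_10_10_isIsoV_of_frobAlg_equiv : Prop :=
  ∀ (k : Type) [Field k] [IsAlgClosed k] (p : ℕ) [Fact p.Prime] [CharP k p] [Algebra (ZMod p) k]
    [Algebra.IsAlgebraic (ZMod p) k] (r : ℕ), 0 < r →
    ∀ (c : ℚ), 0 < c → padicValRat p c = r →
    ∀ (X Y : VirtualAbelianVariety k p r), X.InVc c → Y.InVc c → X.IsSimpleV → Y.IsSimpleV →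
    (∃ e : X.frobAlg ≃ₐ[ℚ] Y.frobAlg, e X.frobGen = Y.frobGen) → X.IsIsoV Y

/-! ## Lemma 10.11 (pp. 407–408), the dimension identity -/

/-- **[Kottwitz1992, Lemma 10.11 (pp. 407–408)]**, verbatim: «Let `A` be a simple object in `𝒱_{r,c}` with
Frobenius element `π` and endomorphism algebra `E`. The Hasse invariant of the central division algebra `E` over
`ℚ[π]` at a place `v` of `ℚ[π]` is given by `1/2` if `v` is real, `[ℚ[π]_v : ℚ_p] v(π)/v(p^r)` if `v` divides
`p`, `0` otherwise. Moreover the following equality holds: `2 dim(A) = [ℚ[π] : ℚ] (dim_{ℚ[π]} E)^{1/2}`.»  Typed: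
the dimension identity, squared and over `ℚ` (`dim_ℚ E = [ℚ[π]:ℚ] · dim_{ℚ[π]} E`):
`(2 dim Ā)² = [ℚ[π]:ℚ] · dim_ℚ E` with `E = End_{𝒱_r}(A)`.  The invariant table is not typed (module
docstring). [cite: Kottwitz1992, Lemma 10.11 (pp. 407–408)] -/
def Kottwitz1992_10_11_dim_sq_eq : Prop :=
  ∀ (k : Type) [Field k] [IsAlgClosed k] (p : ℕ) [Fact p.Prime] [CharP k p] [Algebra (ZMod p) k]
    [Algebra.IsAlgebraic (ZMod p) k] (r : ℕ), 0 < r →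
    ∀ (c : ℚ), 0 < c → padicValRat p c = r →
    ∀ (X : VirtualAbelianVariety k p r), X.InVc c → X.IsSimpleV →
    (2 * X.A.dim) ^ 2 = Module.finrank ℚ X.frobAlg * Module.finrank ℚ X.endAlg

/-! ## Lemma 10.12 (p. 408) -/

/-- **[Kottwitz1992, Lemma 10.12 (p. 408)]**, verbatim: «Every `c`-number `π ∈ ℚ̄` arises from some simple object
in `𝒱_{r,c}`.» — i.e. (p. 408: «The image of `π` under an embedding `ℚ[π] → ℚ̄` is a `c`-number `π ∈ ℚ̄` whose
`Gal(ℚ̄/ℚ)`-orbit is independent of the choice of embedding») for every `c`-number `a` in a number field `K`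
there are a simple `A ∈ 𝒱_{r,c}` and a `ℚ`-algebra homomorphism `ℚ[π_A] → K` sending `π_A` to `a` (proof
pp. 408–409 by Honda–Tate theory [H, T3]). [cite: Kottwitz1992, Lemma 10.12 (p. 408)] -/
def Kottwitz1992_10_12_exists_simple_of_isCNumber : Prop :=
  ∀ (k : Type) [Field k] [IsAlgClosed k] (p : ℕ) [Fact p.Prime] [CharP k p] [Algebra (ZMod p) k]
    [Algebra.IsAlgebraic (ZMod p) k] (r : ℕ), 0 < r →
    ∀ (c : ℚ), 0 < c → padicValRat p c = r →
    ∀ (K : Type) [Field K] [NumberField K] (a : K), IsCNumber p c a →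
    ∃ X : VirtualAbelianVariety k p r, X.InVc c ∧ X.IsSimpleV ∧
      ∃ φ : X.frobAlg →ₐ[ℚ] K, φ X.frobGen = a

/-! ## Lemma 10.13 (pp. 409–410) -/

/-- **[Kottwitz1992, Lemma 10.13 (p. 409)], surjectivity of `π ↦ X_π`**, verbatim context: «Let `B` be a simple
algebra of dimension `d²` over a number field `F`. … the category `𝒱_{r,c,B}` of `B`-objects in the category of
`c`-polarizable virtual abelian varieties over `k_r` up to isogeny. Let `π` be a `c`-number in `F̄`. … we then
get a simple object `X_π` in `𝒱_{r,c,B}`»; Lemma 10.13: «The construction `π ↦ X_π` sets up a bijection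
between `c`-numbers in `F̄` up to conjugacy over `F` and isomorphism classes of simple objects in `𝒱_{r,c,B}`.»
Typed: for every `c`-number `a` in a number field `K ⊇ F` there is a simple `B`-object `(X, i)` of `𝒱_{r,c,B}`
with an `F`-compatible `ℚ`-algebra homomorphism `F[π_X] → K` sending `π_X` to `a`.
[cite: Kottwitz1992, Lemma 10.13 (p. 409)] -/
def Kottwitz1992_10_13_exists : Prop :=
  ∀ (k : Type) [Field k] [IsAlgClosed k] (p : ℕ) [Fact p.Prime] [CharP k p] [Algebra (ZMod p) k]
    [Algebra.IsAlgebraic (ZMod p) k] (r : ℕ), 0 < r →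
    ∀ (c : ℚ), 0 < c → padicValRat p c = r →
    ∀ (F B : Type) [Field F] [NumberField F] [Ring B] [Algebra F B] [Algebra ℚ B] [IsScalarTower ℚ F B]
      [Algebra.IsCentral F B] [IsSimpleRing B] [FiniteDimensional F B]
      (K : Type) [Field K] [NumberField K] [Algebra F K] (a : K), IsCNumber p c a →
    ∃ (X : VirtualAbelianVariety k p r) (i : B →ₐ[ℚ] X.A.endAlgebra), X.InVc c ∧ X.IsSimpleBV i ∧
      ∃ φ : X.frobAlgF F i →ₐ[ℚ] K, φ (X.frobGenF F i) = a ∧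
        ∀ (x : F) (hx : i (algebraMap F B x) ∈ X.frobAlgF F i),
          φ ⟨i (algebraMap F B x), hx⟩ = algebraMap F K x

/-- **[Kottwitz1992, Lemma 10.13 (p. 409)], injectivity of `π ↦ X_π`**: two simple `B`-objects `(X, i)`, `(Y, j)`
of `𝒱_{r,c,B}` whose `c`-numbers are conjugate over `F` — an `F`-compatible `ℚ`-algebra isomorphism
`F[π_X] ≅ F[π_Y]` carrying `π_X` to `π_Y` — are isomorphic `B`-objects: there is an isogeny `Ā_X → Ā_Y`
compatible with the Frobenius elements and `B`-linear. [cite: Kottwitz1992, Lemma 10.13 (p. 409)] -/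
def Kottwitz1992_10_13_unique : Prop :=
  ∀ (k : Type) [Field k] [IsAlgClosed k] (p : ℕ) [Fact p.Prime] [CharP k p] [Algebra (ZMod p) k]
    [Algebra.IsAlgebraic (ZMod p) k] (r : ℕ), 0 < r →
    ∀ (c : ℚ), 0 < c → padicValRat p c = r →
    ∀ (F B : Type) [Field F] [NumberField F] [Ring B] [Algebra F B] [Algebra ℚ B] [IsScalarTower ℚ F B]
      [Algebra.IsCentral F B] [IsSimpleRing B] [FiniteDimensional F B]
      (X Y : VirtualAbelianVariety k p r) (i : B →ₐ[ℚ] X.A.endAlgebra) (j : B →ₐ[ℚ] Y.A.endAlgebra),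
      X.InVc c → Y.InVc c → X.IsSimpleBV i → Y.IsSimpleBV j →
      (∃ e : X.frobAlgF F i ≃ₐ[ℚ] Y.frobAlgF F j, e (X.frobGenF F i) = Y.frobGenF F j ∧
        ∀ (x : F) (hx : i (algebraMap F B x) ∈ X.frobAlgF F i) (hy : j (algebraMap F B x) ∈ Y.frobAlgF F j),
          e ⟨i (algebraMap F B x), hx⟩ = ⟨j (algebraMap F B x), hy⟩) →
      ∃ f : X.A ⟶ Y.A, IsIsogeny f ∧ IsHom Y f ∧ IsBHom Y i j f

/-- **[Kottwitz1992, Lemma 10.13 (pp. 409–410)], endomorphism algebra and dimension**, verbatim: «The endomorphism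
algebra `End(X_π)` is a central division algebra `C` over `F[π]` … Moreover the dimension of the abelian variety
`Ā` over `k` underlying `X_π` is given by `2 dim(Ā) = d [F[π] : ℚ] (dim_{F[π]} C)^{1/2}`» (`d² = dim_F B`).  Typed,
squared and over `ℚ`: `(2 dim Ā)² = dim_F B · [F[π]:ℚ] · dim_ℚ C` with `C = End_B(X)`; the Hasse-invariant table
of `C` is not typed (module docstring). [cite: Kottwitz1992, Lemma 10.13 (pp. 409–410)] -/
def Kottwitz1992_10_13_dim_sq_eq : Prop :=
  ∀ (k : Type) [Field k] [IsAlgClosed k] (p : ℕ) [Fact p.Prime] [CharP k p] [Algebra (ZMod p) k]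
    [Algebra.IsAlgebraic (ZMod p) k] (r : ℕ), 0 < r →
    ∀ (c : ℚ), 0 < c → padicValRat p c = r →
    ∀ (F B : Type) [Field F] [NumberField F] [Ring B] [Algebra F B] [Algebra ℚ B] [IsScalarTower ℚ F B]
      [Algebra.IsCentral F B] [IsSimpleRing B] [FiniteDimensional F B]
      (X : VirtualAbelianVariety k p r) (i : B →ₐ[ℚ] X.A.endAlgebra), X.InVc c → X.IsSimpleBV i →
    (2 * X.A.dim) ^ 2 =
      Module.finrank F B * Module.finrank ℚ (X.frobAlgF F i) * Module.finrank ℚ (X.endAlgB i)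

end Literature.NumberTheory.Kottwitz1992.VirtualAbelianVarieties
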